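import Summits.SmoothPoincare4.SmoothPoincare4.Theorems.ConvexBisectionAcyclicBisectionExistsComplementPieceBump
import Summits.SmoothPoincare4.SmoothPoincare4.Theorems.ConvexBisectionAcyclicBisectionExistsDualHandleModelRegion
import Literature.Topology.FourManifolds.RegularLevelSplitting
import HarnessLib

/-!
# The complement piece `W₂`, IV: the level function `Φ` of the complement piece and its regularity
(helper file 4 of the wave-4 brick T3b (iii) "the complement piece `W₂ = {Φ ≤ 0}` of the pushed
prefix sub-handlebody inside Milnor's gluing" for stub `stub_steinRealisation` (NF6), line
`modp-braid-orbits` r11, crux `ConvexBisection.AcyclicBisectionExists`, item stmt-SmoothPoincare4-10508;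
lead c5, worker Y6)

With the signed seam level `Φ₀ = seamLevelFn G` of Milnor's gluing `M' = X ∪_Ψ W` (file I), the glued
handle charts `Θⱼ` of the suffix handles `f j` (file II) and the push-forwards `Ψⱼ` of the cocore bumps
(file III), **the level function of the complement piece** is

  `Φ = levelFn D f G a κ δ := Φ₀ + Σⱼ Ψⱼ`,   `Φ ∘ Θⱼ = levelLoc = (1 - Ω) · Φ₀ ∘ Θⱼ + Ω · H`

(V5-REPORT §3.2: `Φ := (1 - Ωⱼ) Φ₀ + Ωⱼ (Hⱼ ∘ Ξⱼ⁻¹)`).  It is smooth, and **`0` is a regular value**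
(`not_isMCriticalPt_levelFn`, `isRegularLevel_levelFn`): off the bump images `Φ = Φ₀` near the point
and the seam is a regular level of `Φ₀`; at a chart point a critical point of `Φ` would be a critical
point of `levelLoc` (chain rule), and the zeros of `levelLoc` in the support box are (i) interior points
or sphere points with `‖x_λ‖² < 13κ²/16`, near which `Ω ≡ 1` and `levelLoc ≡ H` with `dH ≠ 0` (Z2's
`fderiv_modelH_ne_zero`), or (ii) sphere points with `‖x_λ‖² ≥ 13κ²/16 > 3κ²/4`, where along the ray
`t ↦ t • x` one has `levelLoc (t • x) = (1 - Ω)·s(t) + Ω·(1 - t²)` (`s` the seam height, `H = 1 - ‖x‖²`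
on Z2's plateau) with derivative `-(2/a)(1 - Ω) - 2Ω < 0` at `t = 1`; outside the closed ball
`levelLoc < 0`.  Everything here is proved; no named facts.

## References
* J. Milnor, *Morse theory* (1963), §2–§3, Thm. 3.1. [Milnor1963]
* A. A. Kosinski, *Differential Manifolds* (1993), VI §6. [Kosinski1993]
-/

noncomputable section

-- the prescribed namespace `Summit.<P>.<Sub>.…` duplicates `SmoothPoincare4` (P = Sub)
set_option linter.dupNamespace false

open scoped Manifold ContDiff Topology

namespace Summit.SmoothPoincare4.SmoothPoincare4.Theorems.AcyclicBisectionExists.ModpBraidOrbits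

open Set Function Metric Filter Topology
open Literature.Topology.FourManifolds Literature.Topology.FourManifolds.HandleAttachingMap

section Level

variable {B : Type} [TopologicalSpace B] [T2Space B] [ChartedSpace (EuclideanHalfSpace 4) B]
  {ι : Type} [Finite ι] {h : ι → HandleAttachingMap 3 2 B}
  {X : Type} [TopologicalSpace X] [ChartedSpace (EuclideanHalfSpace 4) X] [IsManifold (𝓡∂ 4) ∞ X]
  (D : MultiAttachmentData h (𝓡∂ 4) X) (i : ι) {ι' : Type} [Finite ι'] (f : ι' → ι)
  {bX : BoundaryData (𝓡∂ 4) X (𝓡 3)}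
  {W : Type} [TopologicalSpace W] [ChartedSpace (EuclideanHalfSpace 4) W]
  [IsManifold (𝓡∂ 4) ∞ W] {bW : BoundaryData (𝓡∂ 4) W (𝓡 3)} [Nonempty bX.carrier]
  (G : BoundaryGlueData bX bW) (a κ δ : ℝ)

/-! ### §1 The local and the global level function -/

/-- **The level function in the `i`-th chart**: `levelLoc x = Φ₀ (Θᵢ x) + gᵢ x`. [cite: Milnor1963, §3] -/
def levelLoc (x : EuclideanSpace ℝ (Fin 4)) : ℝ :=
  seamLevelFn G (gluedHandleChart D i G a x) + bumpFn D i G a κ δ x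

/-- **THE LEVEL FUNCTION OF THE COMPLEMENT PIECE** `Φ = Φ₀ + Σⱼ Ψⱼ` on Milnor's gluing (sum over the suffix
handles `f j`). [cite: Milnor1963, Thm. 3.1] -/
def levelFn : G.d₂.Glued → ℝ := fun p => seamLevelFn G p + ∑ᶠ j : ι', bumpPush D (f j) G a κ δ p

/-- The union of the images of the support boxes of the suffix handles. [folklore] -/
def bumpImages : Set G.d₂.Glued := ⋃ j : ι', gluedHandleChart D (f j) G a '' bumpSupp κ a

variable {a κ δ}

/-- `levelLoc = (1 - Ω) · Φ₀ ∘ Θᵢ + Ω · H`. [folklore] -/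
theorem levelLoc_eq (x : EuclideanSpace ℝ (Fin 4)) :
    levelLoc D i G a κ δ x =
      (1 - bumpLoc κ a x) * seamLevelFn G (gluedHandleChart D i G a x) + bumpLoc κ a x * modelH κ δ x := by
  unfold levelLoc bumpFn; ring

/-- `Φ₀ ∘ Θᵢ` on the seam zone is the signed profile of the seam height. [folklore] -/
theorem seamLevelFn_chart_of_mem_seamZone (ha : 0 < a) (hCM : CollarAdapted D i G a)
    {x : EuclideanSpace ℝ (Fin 4)} (hx : x ∈ seamZone a) :
    seamLevelFn G (gluedHandleChart D i G a x) = signedHeightProfile (seamHeight a x) := by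
  rw [gluedHandleChart_eq_inl_inl D i G ha hCM hx]
  rfl

/-- `Φ₀ ∘ Θᵢ > 0` on the open ball (interior points of `X`). [folklore] -/
theorem seamLevelFn_chart_pos {x : EuclideanSpace ℝ (Fin 4)} (hx : ‖x‖ < 1) :
    0 < seamLevelFn G (gluedHandleChart D i G a x) := by
  rw [gluedHandleChart_of_norm_lt_one D i G a hx]
  exact seamLevelFn_jM_pos G (isInteriorPoint_jB D i (by rw [coe_beltBallPt hx]; exact hx))

/-- **Where `Ω ≡ 1` the local level function is `H`** (near points with `‖x_λ‖² < 13κ²/16`,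
`‖x‖² < 1 + d/3`). [folklore] -/
theorem levelLoc_eventuallyEq_modelH (hκ : 0 < κ) (ha : 0 < a) {x : EuclideanSpace ℝ (Fin 4)}
    (hP : ‖lamPart x‖ ^ 2 < 13 * κ ^ 2 / 16) (hr : ‖x‖ ^ 2 < 1 + min (1 / 5) a / 3) :
    levelLoc D i G a κ δ =ᶠ[𝓝 x] modelH κ δ := by
  have hU : IsOpen {y : EuclideanSpace ℝ (Fin 4) | ‖lamPart y‖ ^ 2 < 13 * κ ^ 2 / 16 ∧ ‖y‖ ^ 2 < 1 + min (1 / 5) a / 3} :=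
    (isOpen_lt contDiff_lamNormSq.continuous continuous_const).inter
      (isOpen_lt (continuous_norm.pow 2) continuous_const)
  filter_upwards [hU.mem_nhds ⟨hP, hr⟩] with y hy
  rw [levelLoc_eq, bumpLoc_eq_one hκ ha hy.1.le hy.2.le]
  ring

variable [CompactSpace X] [T2Space X] [T2Space W] [CompactSpace W]

/-- The local level function is smooth on the chart domain. [folklore] -/
theorem contMDiffOn_levelLoc (ha : 0 < a) (hCM : CollarAdapted D i G a) :
    ContMDiffOn 𝓘(ℝ, EuclideanSpace ℝ (Fin 4)) 𝓘(ℝ, ℝ) ∞ (levelLoc D i G a κ δ) (chartDom a) :=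
  (contMDiffOn_seamLevelFn_chart D i G ha hCM).add (contMDiffOn_bumpFn D i G ha hCM)

/-- The local level function is differentiable at points of the chart domain. [folklore] -/
theorem differentiableAt_levelLoc (ha : 0 < a) (hCM : CollarAdapted D i G a) {x : EuclideanSpace ℝ (Fin 4)}
    (hx : x ∈ chartDom a) : DifferentiableAt ℝ (levelLoc D i G a κ δ) x := by
  have h1 := ((contMDiffOn_levelLoc D i G ha hCM (κ := κ) (δ := δ)).contMDiffAt
    ((isOpen_chartDom a).mem_nhds hx))
  rw [contMDiffAt_iff_contDiffAt] at h1
  exact h1.differentiableAt (by simp)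

/-- **The level function is smooth.** [cite: Milnor1963, §3] -/
theorem contMDiff_levelFn (ha : 0 < a) (hCM : ∀ j, CollarAdapted D (f j) G a) (hκ : 0 < κ) (hκ2 : κ ≤ 1 / 2) :
    ContMDiff 𝓘(ℝ, EuclideanSpace ℝ (Fin 4)) 𝓘(ℝ, ℝ) ∞ (levelFn D f G a κ δ) :=
  (contMDiff_seamLevelFn G).add
    (contMDiff_finsum (fun j => contMDiff_bumpPush D (f j) G ha (hCM j) hκ hκ2) (locallyFinite_of_finite _))

omit [Finite ι'] [CompactSpace X] [T2Space X] [T2Space W] [CompactSpace W] in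
/-- **`Φ ∘ Θⱼ = levelLoc` on the chart domain** (the push-forwards of the other handles vanish there).
[folklore] -/
theorem levelFn_apply_chart (ha : 0 < a) (hf : Injective f) (hCM : ∀ j, CollarAdapted D (f j) G a) (hκ : 0 < κ)
    (hκ2 : κ ≤ 1 / 2) (j : ι') {x : EuclideanSpace ℝ (Fin 4)} (hx : x ∈ chartDom a) :
    levelFn D f G a κ δ (gluedHandleChart D (f j) G a x) = levelLoc D (f j) G a κ δ x := by
  unfold levelFn levelLoc
  congr 1
  rw [finsum_eq_single _ j fun j' hj' =>
    bumpPush_chart_ne D G ha (hf.ne (Ne.symm hj')) (hCM j) (hCM j') hκ hκ2 hx]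
  exact bumpPush_apply_chart D (f j) G ha (hCM j) hx

omit [Finite ι'] [CompactSpace X] [T2Space X] [T2Space W] [CompactSpace W] in
/-- **`Φ = Φ₀` off the bump images.** [folklore] -/
theorem levelFn_eq_seamLevelFn (ha : 0 < a) (hCM : ∀ j, CollarAdapted D (f j) G a) (hκ : 0 < κ)
    {p : G.d₂.Glued} (hp : p ∉ bumpImages D f G a κ) : levelFn D f G a κ δ p = seamLevelFn G p := by
  unfold levelFn
  rw [finsum_eq_zero_of_forall_eq_zero fun j =>
    bumpPush_eq_zero_of_not_mem D (f j) G ha (hCM j) hκ fun h' => hp (mem_iUnion.2 ⟨j, h'⟩), add_zero]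

omit [CompactSpace W] in
/-- The bump images form a closed set. [folklore] -/
theorem isClosed_bumpImages (ha : 0 < a) (hCM : ∀ j, CollarAdapted D (f j) G a) (hκ : 0 < κ) (hκ2 : κ ≤ 1 / 2) :
    IsClosed (bumpImages D f G a κ) :=
  isClosed_iUnion_of_finite fun j => isClosed_image_bumpSupp D (f j) G ha (hCM j) hκ hκ2

omit [CompactSpace W] in
/-- **`Φ = Φ₀` near every point off the bump images.** [folklore] -/
theorem levelFn_eventuallyEq (ha : 0 < a) (hCM : ∀ j, CollarAdapted D (f j) G a) (hκ : 0 < κ) (hκ2 : κ ≤ 1 / 2)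
    {p : G.d₂.Glued} (hp : p ∉ bumpImages D f G a κ) : levelFn D f G a κ δ =ᶠ[𝓝 p] seamLevelFn G := by
  filter_upwards [(isClosed_bumpImages D f G ha hCM hκ hκ2).isOpen_compl.mem_nhds hp] with q hq
  exact levelFn_eq_seamLevelFn D f G ha hCM hκ hq

/-! ### §2 Regularity of the local level function at its zeros in the support box -/

omit [CompactSpace X] [T2Space X] [T2Space W] [CompactSpace W] in
/-- **The ray derivative at a sphere zero on Z2's plateau**: for `x` in the seam zone with `‖x‖ = 1` and
`‖x_λ‖² > 3κ²/4`, `t ↦ levelLoc (t • x)` has derivative `-(2/a)(1 - Ω x) - 2 Ω x` at `t = 1`.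
[cite: Milnor1963, §3] -/
theorem hasDerivAt_levelLoc_ray (ha : 0 < a) (hCM : CollarAdapted D i G a) (hκ : 0 < κ) (hδ : 0 < δ)
    (hδ2 : δ ≤ 1 / 2) {x : EuclideanSpace ℝ (Fin 4)} (hx : x ∈ seamZone a) (hn : ‖x‖ = 1)
    (hP : 3 * κ ^ 2 / 4 < ‖lamPart x‖ ^ 2) :
    HasDerivAt (fun t : ℝ => levelLoc D i G a κ δ (t • x))
      (-(2 / a) * (1 - bumpLoc κ a x) - 2 * bumpLoc κ a x) 1 := by
  -- the explicit function along the ray near `t = 1`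
  set sg : ℝ → ℝ := fun t => (1 - t ^ 2) / (a - 1 + t ^ 2) with hsg
  set wt : ℝ → ℝ := fun t => bumpLoc κ a (t • x) with hwt
  have hsg1 : sg 1 = 0 := by simp [hsg]
  have hwt1 : wt 1 = bumpLoc κ a x := by simp [hwt]
  have hQ : 3 / 4 < ‖muPart x‖ ^ 2 := by
    have h1 := norm_sq_eq_lamPart_muPart x
    rw [hn] at h1
    nlinarith [hx.2.1, norm_nonneg (lamPart x)]
  -- eventual identities along the ray
  have e1 : ∀ᶠ t : ℝ in 𝓝 1, t • x ∈ seamZone a := eventually_smul_mem (isOpen_seamZone a) hx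
  have e2 : ∀ᶠ t : ℝ in 𝓝 1, |sg t| < 2⁻¹ := by
    have hc : ContinuousAt sg 1 := by
      refine ((continuous_const.sub (continuous_pow 2)).continuousAt).div
        ((continuous_const.add (continuous_pow 2)).continuousAt) ?_
      norm_num; exact ha.ne'
    have := hc.eventually (Metric.ball_mem_nhds (sg 1) (by norm_num : (0 : ℝ) < 2⁻¹))
    filter_upwards [this] with t ht
    have ht' : dist (sg t) (sg 1) < 2⁻¹ := ht
    rwa [hsg1, Real.dist_eq, sub_zero] at ht'
  have e3 : ∀ᶠ t : ℝ in 𝓝 1, 3 * κ ^ 2 / 4 < t ^ 2 * ‖lamPart x‖ ^ 2 ∧ 3 / 4 < t ^ 2 * ‖muPart x‖ ^ 2 := by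
    have hc1 : ContinuousAt (fun t : ℝ => t ^ 2 * ‖lamPart x‖ ^ 2) 1 :=
      ((continuous_pow 2).mul continuous_const).continuousAt
    have hc2 : ContinuousAt (fun t : ℝ => t ^ 2 * ‖muPart x‖ ^ 2) 1 :=
      ((continuous_pow 2).mul continuous_const).continuousAt
    have h1 := hc1.eventually (lt_mem_nhds (show 3 * κ ^ 2 / 4 < (1 : ℝ) ^ 2 * ‖lamPart x‖ ^ 2 by simpa using hP))
    have h2 := hc2.eventually (lt_mem_nhds (show 3 / 4 < (1 : ℝ) ^ 2 * ‖muPart x‖ ^ 2 by simpa using hQ))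
    exact h1.and h2
  have hev : (fun t : ℝ => levelLoc D i G a κ δ (t • x)) =ᶠ[𝓝 1]
      fun t => sg t + wt t * ((1 - t ^ 2) - sg t) := by
    filter_upwards [e1, e2, e3] with t ht1 ht2 ht3
    have hsh : seamHeight a (t • x) = sg t := seamHeight_smul_unit hn a t
    have hPt : 3 * κ ^ 2 / 4 ≤ ‖lamPart (t • x)‖ ^ 2 := by rw [norm_lamPart_smul_sq]; exact ht3.1.le
    have hQt : δ / 2 ≤ ‖muPart (t • x)‖ ^ 2 := by rw [norm_muPart_smul_sq]; linarith [ht3.2]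
    show levelLoc D i G a κ δ (t • x) = sg t + wt t * ((1 - t ^ 2) - sg t)
    unfold levelLoc bumpFn
    rw [seamLevelFn_chart_of_mem_seamZone D i G ha hCM ht1, hsh, signedHeightProfile_of_abs_le ht2.le,
      modelH_eq_one_sub_norm_sq hκ hδ hPt hQt, norm_smul_unit_sq hn]
  -- the derivative of the explicit function
  have hsgd : HasDerivAt sg (-(2 / a)) 1 := hasDerivAt_seamHeight_ray ha
  have hwtd : HasDerivAt wt (deriv wt 1) 1 := by
    have : Differentiable ℝ wt :=
      ((contDiff_bumpLoc κ a).differentiable (by simp)).comp (differentiable_id.smul_const x)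
    exact (this 1).hasDerivAt
  have hq : HasDerivAt (fun t : ℝ => 1 - t ^ 2) (-(2 : ℝ)) 1 := by
    simpa using (hasDerivAt_pow 2 (1 : ℝ)).const_sub (1 : ℝ)
  have hψ := hsgd.fun_add (hwtd.fun_mul (hq.fun_sub hsgd))
  have hψ' : HasDerivAt (fun t => sg t + wt t * ((1 - t ^ 2) - sg t))
      (-(2 / a) * (1 - bumpLoc κ a x) - 2 * bumpLoc κ a x) 1 := by
    refine hψ.congr_deriv ?_
    rw [hsg1, hwt1]
    ring
  exact hψ'.congr_of_eventuallyEq hev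

/-- **At a sphere zero on the plateau the differential of `levelLoc` is non-zero** (its value on the
radial vector is `-(2/a)(1 - Ω) - 2Ω < 0`). [cite: Milnor1963, §3] -/
theorem fderiv_levelLoc_ne_zero_of_sphere (ha : 0 < a) (hCM : CollarAdapted D i G a) (hκ : 0 < κ) (hδ : 0 < δ)
    (hδ2 : δ ≤ 1 / 2) {x : EuclideanSpace ℝ (Fin 4)} (hx : x ∈ seamZone a) (hn : ‖x‖ = 1)
    (hP : 3 * κ ^ 2 / 4 < ‖lamPart x‖ ^ 2) : fderiv ℝ (levelLoc D i G a κ δ) x ≠ 0 := by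
  intro h0
  have hd : DifferentiableAt ℝ (levelLoc D i G a κ δ) x := differentiableAt_levelLoc D i G ha hCM (Or.inr hx)
  have h1 : HasDerivAt (fun t : ℝ => levelLoc D i G a κ δ (t • x)) (fderiv ℝ (levelLoc D i G a κ δ) x x) 1 := by
    have hl : HasDerivAt (fun t : ℝ => t • x) ((1 : ℝ) • x) 1 := (hasDerivAt_id (1 : ℝ)).smul_const x
    rw [one_smul] at hl
    have hd' : HasFDerivAt (levelLoc D i G a κ δ) (fderiv ℝ (levelLoc D i G a κ δ) x) ((1 : ℝ) • x) := by
      rw [one_smul]; exact hd.hasFDerivAt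
    exact hd'.comp_hasDerivAt (1 : ℝ) hl
  have h2 := hasDerivAt_levelLoc_ray D i G ha hCM hκ hδ hδ2 hx hn hP (κ := κ)
  have heq := h1.unique h2
  rw [h0] at heq
  have hω := bumpLoc_mem κ a x
  have hm0 : 0 < min (2 / a) 2 := lt_min (by positivity) two_pos
  have hA := mul_le_mul_of_nonneg_left (min_le_left (2 / a) 2) (sub_nonneg.2 hω.2)
  have hB := mul_le_mul_of_nonneg_left (min_le_right (2 / a) 2) hω.1
  have hzero : (0 : ℝ) = -(2 / a) * (1 - bumpLoc κ a x) - 2 * bumpLoc κ a x := by simpa using heq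
  nlinarith

/-- **Every zero of `levelLoc` in the support box is a regular point.** [cite: Milnor1963, Thm. 3.1] -/
theorem fderiv_levelLoc_ne_zero (ha : 0 < a) (hCM : CollarAdapted D i G a) (hκ : 0 < κ) (hκ2 : κ ≤ 1 / 2)
    (hδ : 0 < δ) (hδ2 : δ ≤ 1 / 2) {x : EuclideanSpace ℝ (Fin 4)} (hx : x ∈ bumpSupp κ a)
    (h0 : levelLoc D i G a κ δ x = 0) : fderiv ℝ (levelLoc D i G a κ δ) x ≠ 0 := by
  have hd : 0 < min (1 / 5 : ℝ) a := lt_min (by norm_num) ha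
  have hκsq : 0 < κ ^ 2 := by positivity
  have hω := bumpLoc_mem κ a x
  rcases lt_trichotomy ‖x‖ 1 with hn | hn | hn
  · -- interior zero: `Φ₀ ∘ Θ > 0` forces `H ≤ 0`, hence `‖x_λ‖² ≤ 3κ²/4` and `levelLoc ≡ H` nearby
    have hpos := seamLevelFn_chart_pos D i G (a := a) hn
    have hH : modelH κ δ x ≤ 0 := by
      by_contra hH
      push Not at hH
      rw [levelLoc_eq] at h0
      have h1 : (1 - bumpLoc κ a x) * seamLevelFn G (gluedHandleChart D i G a x) = 0 := by
        nlinarith [mul_nonneg (sub_nonneg.2 hω.2) hpos.le, mul_nonneg hω.1 hH.le]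
      have h2 : bumpLoc κ a x = 1 := by
        rcases mul_eq_zero.1 h1 with h1 | h1
        · linarith
        · exact absurd h1 hpos.ne'
      rw [h2] at h0
      nlinarith
    have hP : ‖lamPart x‖ ^ 2 ≤ 3 * κ ^ 2 / 4 := by
      by_contra hP
      push Not at hP
      exact absurd (modelH_pos_of_lamSq_gt hκ hκ2 hδ hn hP) (not_lt.2 hH)
    have hev := levelLoc_eventuallyEq_modelH D i G (δ := δ) hκ ha (x := x) (by nlinarith)
      (by nlinarith [norm_nonneg x])
    rw [hev.fderiv_eq]
    exact fderiv_modelH_ne_zero hκ hδ (Or.inl hn.le) (by rw [← hev.eq_of_nhds]; exact h0)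
  · -- sphere zero
    have hxs : x ∈ seamZone a :=
      (bumpSupp_subset_chartDom hκ hκ2 ha hx).resolve_left fun h' => by
        rw [mem_ball_zero_iff] at h'; exact h'.ne hn
    by_cases hP : ‖lamPart x‖ ^ 2 < 13 * κ ^ 2 / 16
    · have hev := levelLoc_eventuallyEq_modelH D i G (δ := δ) hκ ha hP (by rw [hn]; linarith)
      rw [hev.fderiv_eq]
      exact fderiv_modelH_ne_zero hκ hδ (Or.inl hn.le) (by rw [← hev.eq_of_nhds]; exact h0)
    · push Not at hP
      exact fderiv_levelLoc_ne_zero_of_sphere D i G ha hCM hκ hδ hδ2 hxs hn (by nlinarith)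
  · -- outside the ball `levelLoc < 0`: no zero
    exfalso
    have hxs : x ∈ seamZone a :=
      (bumpSupp_subset_chartDom hκ hκ2 ha hx).resolve_left fun h' => by
        rw [mem_ball_zero_iff] at h'; linarith
    have hn2 : 1 < ‖x‖ ^ 2 := by nlinarith
    have hΦ : seamLevelFn G (gluedHandleChart D i G a x) < 0 := by
      rw [seamLevelFn_chart_of_mem_seamZone D i G ha hCM hxs]
      refine signedHeightProfile_neg (div_neg_of_neg_of_pos (by linarith) ?_)
      linarith [(depth_of_mem_seamZone hxs).2]
    have hQ : δ / 2 ≤ ‖muPart x‖ ^ 2 := by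
      have h1 := norm_sq_eq_lamPart_muPart x
      have h2 : κ ^ 2 ≤ 1 / 4 := by nlinarith
      nlinarith [hx.1]
    have hH : modelH κ δ x < 0 := (modelH_le_one_sub_norm_sq hκ hκ2 hδ hδ2 hQ).trans_lt (by linarith)
    rw [levelLoc_eq] at h0
    have hA := mul_le_mul_of_nonneg_left (le_max_left (seamLevelFn G (gluedHandleChart D i G a x)) (modelH κ δ x))
      (sub_nonneg.2 hω.2)
    have hB := mul_le_mul_of_nonneg_left (le_max_right (seamLevelFn G (gluedHandleChart D i G a x)) (modelH κ δ x)) hω.1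
    have hM : max (seamLevelFn G (gluedHandleChart D i G a x)) (modelH κ δ x) < 0 := max_lt hΦ hH
    nlinarith

/-! ### §3 `0` is a regular value of `Φ` -/

/-- **Every zero of the level function `Φ` is a regular point.** [cite: Milnor1963, Thm. 3.1] -/
theorem not_isMCriticalPt_levelFn (ha : 0 < a) (hf : Injective f) (hCM : ∀ j, CollarAdapted D (f j) G a)
    (hκ : 0 < κ) (hκ2 : κ ≤ 1 / 2) (hδ : 0 < δ) (hδ2 : δ ≤ 1 / 2) {p : G.d₂.Glued}
    (hp : levelFn D f G a κ δ p = 0) :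
    ¬ IsMCriticalPt 𝓘(ℝ, EuclideanSpace ℝ (Fin 4)) (levelFn D f G a κ δ) p := by
  intro hc
  by_cases hmem : p ∈ bumpImages D f G a κ
  · obtain ⟨j, hj⟩ := mem_iUnion.1 hmem
    obtain ⟨x, hx, rfl⟩ := hj
    have hxV : x ∈ chartDom a := bumpSupp_subset_chartDom hκ hκ2 ha hx
    have hΘ : MDifferentiableAt 𝓘(ℝ, EuclideanSpace ℝ (Fin 4)) 𝓘(ℝ, EuclideanSpace ℝ (Fin 4))
        (gluedHandleChart D (f j) G a) x :=
      ((contMDiffOn_gluedHandleChart D (f j) G ha (hCM j)).contMDiffAt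
        ((isOpen_chartDom a).mem_nhds hxV)).mdifferentiableAt (by simp)
    have hG : MDifferentiableAt 𝓘(ℝ, EuclideanSpace ℝ (Fin 4)) 𝓘(ℝ, ℝ) (levelFn D f G a κ δ)
        (gluedHandleChart D (f j) G a x) :=
      (contMDiff_levelFn D f G ha hCM hκ hκ2 (δ := δ) _).mdifferentiableAt (by simp)
    have heq : (levelFn D f G a κ δ ∘ gluedHandleChart D (f j) G a) =ᶠ[𝓝 x] levelLoc D (f j) G a κ δ := by
      filter_upwards [(isOpen_chartDom a).mem_nhds hxV] with y hy
      exact levelFn_apply_chart D f G ha hf hCM hκ hκ2 j hy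
    have hcrit := isMCriticalPt_of_comp_of_eventuallyEq hΘ hG heq hc
    have h0 : levelLoc D (f j) G a κ δ x = 0 := by
      rw [← levelFn_apply_chart D f G ha hf hCM hκ hκ2 j hxV]; exact hp
    unfold IsMCriticalPt at hcrit
    rw [mfderiv_eq_fderiv] at hcrit
    exact fderiv_levelLoc_ne_zero D (f j) G ha (hCM j) hκ hκ2 hδ hδ2 hx h0 hcrit
  · have hev := levelFn_eventuallyEq D f G ha hCM hκ hκ2 (δ := δ) hmem
    have h0 : seamLevelFn G p = 0 := by
      rw [← levelFn_eq_seamLevelFn D f G ha hCM hκ (δ := δ) hmem]; exact hp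
    refine not_isMCriticalPt_seamLevelFn_of_eq_zero G h0 ?_
    unfold IsMCriticalPt at hc ⊢
    rwa [← hev.mfderiv_eq]

/-- **`0` is a regular level of the level function `Φ` of the complement piece.** [cite: Milnor1963, Thm. 3.1] -/
theorem isRegularLevel_levelFn (ha : 0 < a) (hf : Injective f) (hCM : ∀ j, CollarAdapted D (f j) G a)
    (hκ : 0 < κ) (hκ2 : κ ≤ 1 / 2) (hδ : 0 < δ) (hδ2 : δ ≤ 1 / 2) :
    IsRegularLevel (𝓡 4) (levelFn D f G a κ δ) 0 :=
  isRegularLevel_of_not_isMCriticalPt (contMDiff_levelFn D f G ha hCM hκ hκ2)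
    fun _ hp => not_isMCriticalPt_levelFn D f G ha hf hCM hκ hκ2 hδ hδ2 hp

/-- **Registered helper `helper_levelFn_regular` (sub-goal of `stub_steinRealisation`, T3b (iii), wave 4,
lead c5): the level function `Φ = Φ₀ + Σⱼ Ψⱼ` of the complement piece on Milnor's gluing is smooth with
regular level `0`, equals `levelLoc = (1 - Ω) Φ₀ ∘ Θⱼ + Ω H` on the glued handle charts of the suffix
handles and `Φ₀` off the bump images.** [cite: Milnor1963, Thm. 3.1] -/
theorem helper_levelFn_regular : ∀ {B : Type} [TopologicalSpace B] [T2Space B] [ChartedSpace (EuclideanHalfSpace 4) B] {ι : Type} [Finite ι] {h : ι → Literature.Topology.FourManifolds.HandleAttachingMap 3 2 B} {X : Type} [TopologicalSpace X] [ChartedSpace (EuclideanHalfSpace 4) X] [IsManifold (𝓡∂ 4) ∞ X] (D : Literature.Topology.FourManifolds.HandleAttachingMap.MultiAttachmentData h (𝓡∂ 4) X) {ι' : Type} [Finite ι'] (f : ι' → ι) {bX : Literature.Topology.FourManifolds.BoundaryData (𝓡∂ 4) X (𝓡 3)} {W : Type} [TopologicalSpace W] [ChartedSpace (EuclideanHalfSpace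 4) W] [IsManifold (𝓡∂ 4) ∞ W] {bW : Literature.Topology.FourManifolds.BoundaryData (𝓡∂ 4) W (𝓡 3)} [Nonempty bX.carrier] (G : Literature.Topology.FourManifolds.BoundaryGlueData bX bW) {a κ δ : ℝ} [CompactSpace X] [T2Space X] [T2Space W] [CompactSpace W], 0 < a → Function.Injective f → (∀ j, Summit.SmoothPoincare4.SmoothPoincare4.Theorems.AcyclicBisectionExists.ModpBraidOrbits.CollarAdapted D (f j) G a) → 0 < κ → κ ≤ 1 / 2 → 0 < δ → δ ≤ 1 / 2 → Literature.Topology.FourManifolds.IsRegularLevel (𝓡 4) (Summit.SmoothPoincare4.SmoothPoincare4.Theorems.AcyclicBisectionExists.ModpBraidOrbits.levelFn D f G a κ δ) 0 ∧ (∀ (j : ι') (x : EuclideanSpace ℝ (Fin 4)), x ∈ Summit.SmoothPoincare4.SmoothPoincare4.Theorems.AcyclicBisectionExists.ModpBraidOrbits.chartDom a → Summit.SmoothPoincare4.SmoothPoincare4.Theorems.AcyclicBisectionExists.ModpBraidOrbits.levelFn D f G a κ δ (Summit.SmoothPoincare4.SmoothPoincare4.Theorems.AcyclicBisectionExists.ModpBraidOrbits.gluedHandleChart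 D (f j) G a x) = Summit.SmoothPoincare4.SmoothPoincare4.Theorems.AcyclicBisectionExists.ModpBraidOrbits.levelLoc D (f j) G a κ δ x) ∧ (∀ p, p ∉ Summit.SmoothPoincare4.SmoothPoincare4.Theorems.AcyclicBisectionExists.ModpBraidOrbits.bumpImages D f G a κ → Summit.SmoothPoincare4.SmoothPoincare4.Theorems.AcyclicBisectionExists.ModpBraidOrbits.levelFn D f G a κ δ p = Summit.SmoothPoincare4.SmoothPoincare4.Theorems.AcyclicBisectionExists.ModpBraidOrbits.seamLevelFn G p) := by
  intro B _ _ _ ι _ h X _ _ _ D ι' _ f bX W _ _ _ bW _ G a κ δ _ _ _ _ ha hf hCM hκ hκ2 hδ hδ2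
  exact ⟨isRegularLevel_levelFn D f G ha hf hCM hκ hκ2 hδ hδ2,
    fun j x hx => levelFn_apply_chart D f G ha hf hCM hκ hκ2 j hx,
    fun p hp => levelFn_eq_seamLevelFn D f G ha hCM hκ hp⟩

end Level

end Summit.SmoothPoincare4.SmoothPoincare4.Theorems.AcyclicBisectionExists.ModpBraidOrbits

end
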